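import Mathlib
import Literature.AlgebraicGeometry.Resolution.ShearLiftRecursion
import Literature.AlgebraicGeometry.Resolution.ShearLiftAdicLimit
import Literature.AlgebraicGeometry.Resolution.TotallyPreparedCompletion
import Literature.AlgebraicGeometry.Resolution.CompletedChainCurveStep
import Literature.AlgebraicGeometry.Resolution.CompletedChainTransfer
import Literature.AlgebraicGeometry.Resolution.AxialUnitChainLaw
import Literature.AlgebraicGeometry.Resolution.ExcellentRings
import HarnessLib

/-!
# No infinite tail of rational `τ = 1` fundamental units over an isolated point (ring form; CJS Thm. 13.7 / CP Prop. 4.4)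

Topic: `Literature/AlgebraicGeometry/Resolution`. V. Cossart, U. Jannsen, S. Saito, *Desingularization:
invariants and strategy*, LNM 2270 (2020), Thm. 13.7, Claim 13.8, Thm. 8.24 [cite: CossartJannsenSaito2020, Thm. 13.7];
V. Cossart, O. Piltant, *Resolution of singularities of threefolds in positive characteristic II*, J. Algebra
321 (2009), Prop. 4.4 (proof, p. 11), Lemma 4.5 (2) [cite: CossartPiltant2008, Prop. 4.4]; H. Matsumura,
*Commutative Ring Theory*, §32 p. 256 (G-rings) [cite: Matsumura1987, §32].

OURS — the RING-LEVEL endgame theorem of the `τ = 1` line (the N2 contract of the T1 skeleton,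
`plan/inputs/N2-ENDGAME-DESIGN-p7b-v0.md`, architecture (B) «complete once at the start»): along an infinite
chain of three-dimensional regular local rings with the hypotheses listed in the theorem (near, order exactly
`μ`, `τ = 1` for every regular system, rational, weak transforms as colons, point steps described for every
adapted label, curve steps through a permissible centre, level `0` a G-ring with the closed point isolated in
`{ord ≥ μ}` and an adapted label) one derives `False`. Assembly of tree theorems: shear-lift recursion
(`ShearLiftRecursion`, B3) and its `𝔪`-adic limit (`ShearLiftAdicLimit`, B5a), the totally prepared adapted
coordinate in `R̂₀` (`TotallyPreparedCompletion`, B4), the point and curve steps of the transport down the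
completed chain (`CompletedChainPointStep`, `CompletedChainCurveStep`, with `PreparedCentre` and
`CompletedChainTransfer`), and the axial unit chain law (`AxialUnitChainLaw.false_of_axialChain`). The
quasi-isolation binder `hqis` of the contract is not needed by this route (kept for the interface).
AI-written formalization, weaker than expert review. F-71 / T1 are NOT proved here (T1 consumes this theorem
through `T1_of_phaseA_of_N2`); no summit statement is proved; resolution of singularities in dimension `≥ 4` /
positive characteristic is NOT proved.
-/

noncomputable section

open IsLocalRing MvPolynomial

namespace Literature.AlgebraicGeometry.Resolution

universe u

/-- **B5 (OURS). The transport down the completed chain.** From the shear-lifted third parameters of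
`ShearLiftRecursion` (depth-`N` systems `W_N`), their limit `v̂ ∈ R̂₀` and the totally prepared `ŷ ∈ R̂₀` of
`TotallyPreparedCompletion`: ONE coordinate system `ĉ⁽ⁿ⁾ = (ŷ⁽ⁿ⁾, u_n, ŵ_n)` of `R̂_n` for every `n`, axial at
every step (`y`-axial always, `w`-axial at point steps, `ŵ_{n+1} = φ̂ ŵ_n` at curve steps), generating `𝔪̂_n`,
with `I_n R̂_n ⊆ (ŷ⁽ⁿ⁾, u_n)^μ` at curve steps — by induction on `n` with the invariant «prepared at every
vertex, non-empty polygon, adapted, monic, `ŵ_n` approximated by the `W_N n`» and the one-step theorems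
`completedChain_point_step` / `completedChain_curve_step`. [cite: CossartJannsenSaito2020, Thm. 13.7 (proof), Claim 13.8]
[cite: CossartPiltant2008, Prop. 4.4 (proof, p. 11)] -/
theorem completedChain_transport
    (Rn : ℕ → Type u) [∀ n, CommRing (Rn n)] [∀ n, IsRegularLocalRing (Rn n)]
    (hdim : ∀ n, ringKrullDim (Rn n) = 3) (φ : ∀ n, Rn n →+* Rn (n + 1)) [∀ n, IsLocalHom (φ n)]
    (hφm : ∀ n, (maximalIdeal (Rn n)).map (φ n) ≤ maximalIdeal (Rn (n + 1)))
    (I : ∀ n, Ideal (Rn n)) {μ : ℕ} (u : ∀ n, Rn n) (hu : ∀ n, u (n + 1) = φ n (u n))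
    (pt : ℕ → Prop)
    (hIμ : ∀ n, I n ≤ maximalIdeal (Rn n) ^ μ) (hIne : ∀ n, ¬ I n ≤ maximalIdeal (Rn n) ^ (μ + 1))
    (hτ : ∀ n (c : Fin 3 → Rn n), Ideal.span {c 0, c 1, c 2} = maximalIdeal (Rn n) →
      hironakaTauAt c (I n) μ = 1)
    (hres : ∀ n, Function.Surjective (ResidueField.map (φ n)))
    (hI : ∀ n, I (n + 1) = ((I n).map (φ n)).colon {φ n (u n) ^ μ})
    (hpoint : ∀ n, pt n → ∀ (y w : Rn n), Ideal.span {y, u n, w} = maximalIdeal (Rn n) →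
      (∀ G ∈ initialForms ![y, u n, w] (I n) μ, ∃ a : ResidueField (Rn n), G = C a * X 0 ^ μ) →
      ∃ (a : Rn n) (y' w' : Rn (n + 1)), φ n y = φ n (u n) * y' ∧ φ n (w - a * u n) = φ n (u n) * w' ∧
        Ideal.span {y', φ n (u n), w'} = maximalIdeal (Rn (n + 1)))
    (P : ∀ n, Ideal (Rn n)) (hIP : ∀ n, ¬ pt n → I n ≤ P n ^ μ)
    (hcurve : ∀ n, ¬ pt n → ∀ (y w : Rn n), Ideal.span {y, u n} = P n →
      Ideal.span {y, u n, w} = maximalIdeal (Rn n) →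
      (∀ G ∈ initialForms ![y, u n, w] (I n) μ, ∃ a : ResidueField (Rn n), G = C a * X 0 ^ μ) →
      ∃ y' : Rn (n + 1), φ n y = φ n (u n) * y' ∧
        Ideal.span {y', φ n (u n), φ n w} = maximalIdeal (Rn (n + 1)))
    [hreg : ∀ n, IsRegularLocalRing (AdicCompletion (maximalIdeal (Rn n)) (Rn n))]
    -- B3's output
    (v : ℕ → Rn 0)
    (hchain : ∀ N, ∃ w : ∀ n, Rn n, w 0 = v N ∧
        (∀ n, n < N → pt n → φ n (w n) = φ n (u n) * w (n + 1)) ∧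
        (∀ n, n < N → ¬ pt n → w (n + 1) = φ n (w n)) ∧
        (∀ n, n ≤ N → ∃ y : Rn n, Ideal.span {y, u n, w n} = maximalIdeal (Rn n) ∧
          (¬ pt n → Ideal.span {y, u n} = P n) ∧
          ∀ G ∈ initialForms ![y, u n, w n] (I n) μ, ∃ a : ResidueField (Rn n), G = C a * X 0 ^ μ))
    -- the limit `v̂` (stub B5a) and the totally prepared `ŷ` (B4) at level `0`
    (vh : AdicCompletion (maximalIdeal (Rn 0)) (Rn 0))
    (hvh : ∀ k, ∃ N₀, ∀ N, N₀ ≤ N →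
      vh - algebraMap (Rn 0) (AdicCompletion (maximalIdeal (Rn 0)) (Rn 0)) (v N) ∈
        maximalIdeal (AdicCompletion (maximalIdeal (Rn 0)) (Rn 0)) ^ k)
    (yh : AdicCompletion (maximalIdeal (Rn 0)) (Rn 0))
    (hgen0 : Ideal.span {yh, algebraMap (Rn 0) (AdicCompletion (maximalIdeal (Rn 0)) (Rn 0)) (u 0), vh} =
      maximalIdeal (AdicCompletion (maximalIdeal (Rn 0)) (Rn 0)))
    (hne0 : (pts ![yh, algebraMap (Rn 0) (AdicCompletion (maximalIdeal (Rn 0)) (Rn 0)) (u 0), vh]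
      ((I 0).map (algebraMap (Rn 0) (AdicCompletion (maximalIdeal (Rn 0)) (Rn 0)))) μ).Nonempty)
    (hδ0 : μ.factorial < deltaS ![yh, algebraMap (Rn 0) (AdicCompletion (maximalIdeal (Rn 0)) (Rn 0)) (u 0), vh]
      ((I 0).map (algebraMap (Rn 0) (AdicCompletion (maximalIdeal (Rn 0)) (Rn 0)))) μ)
    (hprep0 : ∀ B, PreparedUpTo ![yh, algebraMap (Rn 0) (AdicCompletion (maximalIdeal (Rn 0)) (Rn 0)) (u 0), vh]
      ((I 0).map (algebraMap (Rn 0) (AdicCompletion (maximalIdeal (Rn 0)) (Rn 0)))) μ B) :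
    ∃ ch : ∀ n, Fin 3 → AdicCompletion (maximalIdeal (Rn n)) (Rn n),
      ch 0 = ![yh, algebraMap (Rn 0) (AdicCompletion (maximalIdeal (Rn 0)) (Rn 0)) (u 0), vh] ∧
      (∀ n, ch n 1 = algebraMap (Rn n) (AdicCompletion (maximalIdeal (Rn n)) (Rn n)) (u n)) ∧
      (∀ n, Ideal.span {ch n 0, ch n 1, ch n 2} = maximalIdeal (AdicCompletion (maximalIdeal (Rn n)) (Rn n))) ∧
      (∀ n, adicCompletionMap (maximalIdeal (Rn n)) (maximalIdeal (Rn (n + 1))) (φ n) (hφm n) (ch n 0) =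
        adicCompletionMap (maximalIdeal (Rn n)) (maximalIdeal (Rn (n + 1))) (φ n) (hφm n) (ch n 1) * ch (n + 1) 0) ∧
      (∀ n, pt n → adicCompletionMap (maximalIdeal (Rn n)) (maximalIdeal (Rn (n + 1))) (φ n) (hφm n) (ch n 2) =
        adicCompletionMap (maximalIdeal (Rn n)) (maximalIdeal (Rn (n + 1))) (φ n) (hφm n) (ch n 1) * ch (n + 1) 2) ∧
      (∀ n, ¬ pt n → ch (n + 1) 2 =
        adicCompletionMap (maximalIdeal (Rn n)) (maximalIdeal (Rn (n + 1))) (φ n) (hφm n) (ch n 2)) ∧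
      (∀ n, ¬ pt n → (I n).map (algebraMap (Rn n) (AdicCompletion (maximalIdeal (Rn n)) (Rn n))) ≤
        Ideal.span {ch n 0, ch n 1} ^ μ) := by
  classical
  -- B3's systems, chosen once for every depth
  choose W hW0 hWax hWcv hWgood using hchain
  have hdimh : ∀ n, ringKrullDim (AdicCompletion (maximalIdeal (Rn n)) (Rn n)) = 3 := fun n => by
    rw [ringKrullDim_adicCompletion, hdim n]
  have hIμh : ∀ n, (I n).map (algebraMap (Rn n) (AdicCompletion (maximalIdeal (Rn n)) (Rn n))) ≤
      maximalIdeal (AdicCompletion (maximalIdeal (Rn n)) (Rn n)) ^ μ := fun n =>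
    map_le_pow_maximalIdeal_adicCompletion (hIμ n)
  have hIneh : ∀ n, ¬ (I n).map (algebraMap (Rn n) (AdicCompletion (maximalIdeal (Rn n)) (Rn n))) ≤
      maximalIdeal (AdicCompletion (maximalIdeal (Rn n)) (Rn n)) ^ (μ + 1) := fun n =>
    not_map_le_pow_maximalIdeal_adicCompletion (hIne n)
  have hIh : ∀ n, (I (n + 1)).map (algebraMap (Rn (n + 1)) (AdicCompletion (maximalIdeal (Rn (n + 1))) (Rn (n + 1)))) =
      (((I n).map (algebraMap (Rn n) (AdicCompletion (maximalIdeal (Rn n)) (Rn n)))).map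
        (adicCompletionMap (maximalIdeal (Rn n)) (maximalIdeal (Rn (n + 1))) (φ n) (hφm n))).colon
        {adicCompletionMap (maximalIdeal (Rn n)) (maximalIdeal (Rn (n + 1))) (φ n) (hφm n)
          (algebraMap (Rn n) (AdicCompletion (maximalIdeal (Rn n)) (Rn n)) (u n)) ^ μ} := fun n =>
    weakTransform_adicCompletion_of_eq (φ n) (hφm n) (hI n)
  -- the invariant of level `n` and the step relation
  obtain ⟨Inv, hInvdef⟩ : ∃ Inv : ∀ n, (Fin 3 → AdicCompletion (maximalIdeal (Rn n)) (Rn n)) → Prop,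
      ∀ n x, Inv n x ↔ (x 1 = algebraMap (Rn n) _ (u n) ∧
        Ideal.span {x 0, x 1, x 2} = maximalIdeal _ ∧
        (∀ B, PreparedUpTo x ((I n).map (algebraMap (Rn n) _)) μ B) ∧
        (pts x ((I n).map (algebraMap (Rn n) _)) μ).Nonempty ∧
        μ.factorial < deltaS x ((I n).map (algebraMap (Rn n) _)) μ ∧
        HasMonic x ((I n).map (algebraMap (Rn n) _)) μ ∧
        (∀ k, ∃ N₀, ∀ N, N₀ ≤ N → x 2 - algebraMap (Rn n) _ (W N n) ∈ maximalIdeal _ ^ k)) :=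
    ⟨_, fun _ _ => Iff.rfl⟩
  have hstep : ∀ n (x : Fin 3 → AdicCompletion (maximalIdeal (Rn n)) (Rn n)), Inv n x →
      ∃ x' : Fin 3 → AdicCompletion (maximalIdeal (Rn (n + 1))) (Rn (n + 1)), Inv (n + 1) x' ∧
        (adicCompletionMap (maximalIdeal (Rn n)) (maximalIdeal (Rn (n + 1))) (φ n) (hφm n) (x 0) =
          adicCompletionMap (maximalIdeal (Rn n)) (maximalIdeal (Rn (n + 1))) (φ n) (hφm n) (x 1) * x' 0) ∧
        (pt n → adicCompletionMap (maximalIdeal (Rn n)) (maximalIdeal (Rn (n + 1))) (φ n) (hφm n) (x 2) =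
          adicCompletionMap (maximalIdeal (Rn n)) (maximalIdeal (Rn (n + 1))) (φ n) (hφm n) (x 1) * x' 2) ∧
        (¬ pt n → x' 2 = adicCompletionMap (maximalIdeal (Rn n)) (maximalIdeal (Rn (n + 1))) (φ n) (hφm n) (x 2)) ∧
        (¬ pt n → (I n).map (algebraMap (Rn n) _) ≤ Ideal.span {x 0, x 1} ^ μ) := by
    intro n x hx
    obtain ⟨hx1, hgenx, hprep, hne, hδ, -, happ⟩ := (hInvdef n x).mp hx
    obtain ⟨N₂, hN₂⟩ := happ 2
    set N := max N₂ (n + 1) with hN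
    have hNn : n ≤ N := le_trans (Nat.le_succ n) (le_max_right _ _)
    have hNn' : n < N := lt_of_lt_of_le (Nat.lt_succ_self n) (le_max_right _ _)
    have hw2 := hN₂ N (le_max_left _ _)
    obtain ⟨yB, hgenB, hPB, hadB⟩ := hWgood N n hNn
    obtain ⟨yB', hgenB', -, -⟩ := hWgood N (n + 1) hNn'
    by_cases hn : pt n
    · obtain ⟨x', hx'1, hgen', hy, hwax, hprep', hne', hδ', hmon', happ'⟩ :=
        completedChain_point_step (φ n) (hφm n) (hdim n) (hdim (n + 1)) (hres n) (u n) (hIμ n) (hIne n)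
          (hIμ (n + 1)) (hIne (n + 1)) (hI n) (hτ (n + 1)) (hpoint n hn) x hx1 hgenx hprep hne hδ (W N n) hw2
          (W N (n + 1)) (hWax N n hNn' hn) ⟨yB', by rw [← hu n]; exact hgenB'⟩
      refine ⟨x', (hInvdef (n + 1) x').mpr ⟨by rw [hx'1, hu n], hgen', hprep', hne', hδ', hmon', fun k => ?_⟩,
        hy, fun _ => hwax, fun h => absurd hn h, fun h => absurd hn h⟩
      obtain ⟨N₁, hN₁⟩ := happ (k + 1)
      refine ⟨max N₁ (n + 1), fun M hM => ?_⟩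
      have hM1 : N₁ ≤ M := le_trans (le_max_left _ _) hM
      have hMn : n < M := lt_of_lt_of_le (Nat.lt_succ_self n) (le_trans (le_max_right _ _) hM)
      exact happ' (W M n) (W M (n + 1)) k (hWax M n hMn hn) (hN₁ M hM1)
    · obtain ⟨x', hx'1, hgen', hy, hwcv, hJcv, hprep', hne', hδ', hmon', happ'⟩ :=
        completedChain_curve_step (φ n) (hφm n) (hdim n) (hdim (n + 1)) (hres n) (u n) (hIμ n) (hIne n)
          (hIμ (n + 1)) (hIne (n + 1)) (hI n) (hτ (n + 1)) (P n) (hIP n hn) (hcurve n hn) x hx1 hgenx hprep hne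
          hδ yB (W N n) (hPB hn) hgenB hadB hw2
      refine ⟨x', (hInvdef (n + 1) x').mpr ⟨by rw [hx'1, hu n], hgen', hprep', hne', hδ', hmon', fun k => ?_⟩,
        hy, fun h => absurd h hn, fun _ => hwcv, fun _ => hJcv⟩
      obtain ⟨N₁, hN₁⟩ := happ k
      refine ⟨max N₁ (n + 1), fun M hM => ?_⟩
      have hM1 : N₁ ≤ M := le_trans (le_max_left _ _) hM
      have hMn : n < M := lt_of_lt_of_le (Nat.lt_succ_self n) (le_trans (le_max_right _ _) hM)
      rw [hWcv M n hMn hn]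
      exact happ' (W M n) k (hN₁ M hM1)
  -- the base system and the recursion
  set x₀ : Fin 3 → AdicCompletion (maximalIdeal (Rn 0)) (Rn 0) :=
    ![yh, algebraMap (Rn 0) (AdicCompletion (maximalIdeal (Rn 0)) (Rn 0)) (u 0), vh] with hx₀
  have hInv0 : Inv 0 x₀ := by
    refine (hInvdef 0 x₀).mpr ⟨rfl, hgen0, hprep0, hne0, hδ0, ?_, fun k => ?_⟩
    · exact hasMonic_of_lt_deltaS x₀ hgen0 (hdimh 0) (hIμh 0) (hIneh 0) hδ0
    · obtain ⟨N₀, hN₀⟩ := hvh k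
      exact ⟨N₀, fun N hN => by rw [hW0 N]; exact hN₀ N hN⟩
  choose next hnextInv hnext₀ hnextpt hnextcv hnextJ using hstep
  let sq : ∀ n, {x : Fin 3 → AdicCompletion (maximalIdeal (Rn n)) (Rn n) // Inv n x} := fun n =>
    Nat.rec (motive := fun n => {x : Fin 3 → AdicCompletion (maximalIdeal (Rn n)) (Rn n) // Inv n x})
      ⟨x₀, hInv0⟩ (fun n ih => ⟨next n ih.1 ih.2, hnextInv n ih.1 ih.2⟩) n
  have hsq : ∀ n, (sq (n + 1)).1 = next n (sq n).1 (sq n).2 := fun n => rfl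
  refine ⟨fun n => (sq n).1, rfl, fun n => ((hInvdef n _).mp (sq n).2).1, fun n => ((hInvdef n _).mp (sq n).2).2.1,
    fun n => ?_, fun n hn => ?_, fun n hn => ?_, fun n hn => ?_⟩
  · exact hnext₀ n (sq n).1 (sq n).2
  · exact hnextpt n (sq n).1 (sq n).2 hn
  · exact hnextcv n (sq n).1 (sq n).2 hn
  · exact hnextJ n (sq n).1 (sq n).2 hn

/-- `(a, b, x + t b) = (a, b, x)` as ideals. [folklore] -/
private theorem span_triple_add_mul_snd' {S : Type u} [CommRing S] (a b x t : S) :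
    Ideal.span ({a, b, x + t * b} : Set S) = Ideal.span {a, b, x} := by
  apply le_antisymm
  · rw [Ideal.span_le]
    rintro z (rfl | rfl | rfl)
    · exact Ideal.subset_span (by simp)
    · exact Ideal.subset_span (by simp)
    · exact Ideal.add_mem _ (Ideal.subset_span (by simp))
        (Ideal.mul_mem_left _ _ (Ideal.subset_span (by simp)))
  · rw [Ideal.span_le]
    rintro z (rfl | rfl | rfl)
    · exact Ideal.subset_span (by simp)
    · exact Ideal.subset_span (by simp)
    · have h1 : z + t * b ∈ Ideal.span ({a, b, z + t * b} : Set S) := Ideal.subset_span (by simp)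
      have h2 : b ∈ Ideal.span ({a, b, z + t * b} : Set S) := Ideal.subset_span (by simp)
      have h := Ideal.sub_mem _ h1 (Ideal.mul_mem_left _ t h2)
      rwa [add_sub_cancel_right] at h

/-- **N2 / B6-assembly (OURS). No infinite tail of RATIONAL `τ = 1` fundamental units over an isolated
point of `{ord ≥ μ}` of an excellent regular threefold, ring form.** Data: regular local rings `R_n` of dimension
`3`, local maps `φ_n`, the exceptional parameter `u_n` (`u_{n+1} = φ_n u_n`), ideals `I_n ⊆ 𝔪_n^μ` of order exactly
`μ` with `τ = 1`, weak transforms `I_{n+1} = (I_n R_{n+1} : u_{n+1}^μ)`, rational residue extensions; at level `0`: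
a G-ring, the closed point isolated in `{ord I₀ ≥ μ}`, and an adapted label `c₀ = (y, u₀, w)` (`L < δs`);
POINT steps (`pt n`): for EVERY label `(y, u_n, w)` adapted to the directrix (`cl_μ I_n ⊆ k·Y^μ`) the near point is
the rational point `(1 : ā)` of the line `L_{x_n}` — `φ y = u_{n+1} y′`, `φ(w − a u_n) = u_{n+1} w′`,
`(y′, u_{n+1}, w′) = 𝔪_{n+1}`; CURVE steps: a centre prime `P_n ∋ u_n` with `I_n ⊆ P_n^μ`, and for every
presentation `P_n = (y, u_n)`, `(y, u_n, w) = 𝔪_n`: `φ y = u_{n+1} y′`, `(y′, u_{n+1}, φ w) = 𝔪_{n+1}`; and the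
centres follow the strict transforms of `div(y)` (`P_{n+1} = (y′, u_{n+1})`). Conclusion: `False`.
[cite: CossartJannsenSaito2020, Thm. 13.7, Claim 13.8, Thm. 8.24] [cite: CossartPiltant2008, Prop. 4.4 (proof, p. 11), Lemma 4.5 (2)]
[cite: Matsumura1987, §32 p. 256] -/
theorem false_of_unitChain_tau_one_rational
    (Rn : ℕ → Type u) [∀ n, CommRing (Rn n)] [∀ n, IsRegularLocalRing (Rn n)]
    (hdim : ∀ n, ringKrullDim (Rn n) = 3) (φ : ∀ n, Rn n →+* Rn (n + 1)) [∀ n, IsLocalHom (φ n)]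
    (I : ∀ n, Ideal (Rn n)) {μ : ℕ} (hμ : 1 ≤ μ) (u : ∀ n, Rn n) (hu : ∀ n, u (n + 1) = φ n (u n))
    (pt : ℕ → Prop) (hpt0 : pt 0)
    -- level `0`: excellence, isolation, an adapted label `(c₀ 0, u 0, c₀ 2)`
    (hG : IsGRing (Rn 0))
    (hisol : ∀ (𝔮 : Ideal (Rn 0)) [𝔮.IsPrime], 𝔮 ≠ maximalIdeal (Rn 0) →
      ¬ (I 0).map (algebraMap (Rn 0) (Localization.AtPrime 𝔮)) ≤ maximalIdeal (Localization.AtPrime 𝔮) ^ μ)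
    (c₀ : Fin 3 → Rn 0) (hc₀ : Ideal.span {c₀ 0, c₀ 1, c₀ 2} = maximalIdeal (Rn 0)) (hc₀u : c₀ 1 = u 0)
    (hδ₀ : μ.factorial < deltaS c₀ (I 0) μ)
    -- every level: near, order exactly `μ`, `τ = 1`, rational, weak transform (EQUALITY with the colon)
    (hIμ : ∀ n, I n ≤ maximalIdeal (Rn n) ^ μ) (hIne : ∀ n, ¬ I n ≤ maximalIdeal (Rn n) ^ (μ + 1))
    (hτ : ∀ n (c : Fin 3 → Rn n), Ideal.span {c 0, c 1, c 2} = maximalIdeal (Rn n) →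
      hironakaTauAt c (I n) μ = 1)
    (hres : ∀ n, Function.Surjective (ResidueField.map (φ n)))
    (hI : ∀ n, I (n + 1) = ((I n).map (φ n)).colon {φ n (u n) ^ μ})
    -- POINT steps of the tail (`hconst`): u-chart, RATIONAL of type `(1 : λ)`, for EVERY adapted label
    (hpoint : ∀ n, pt n → ∀ (y w : Rn n), Ideal.span {y, u n, w} = maximalIdeal (Rn n) →
      (∀ G ∈ initialForms ![y, u n, w] (I n) μ, ∃ a : ResidueField (Rn n), G = C a * X 0 ^ μ) →
      ∃ (a : Rn n) (y' w' : Rn (n + 1)), φ n y = φ n (u n) * y' ∧ φ n (w - a * u n) = φ n (u n) * w' ∧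
        Ideal.span {y', φ n (u n), w'} = maximalIdeal (Rn (n + 1)))
    -- CURVE steps: centre prime, permissibility, chart for EVERY presentation `(y, u_n)` of the centre
    (P : ∀ n, Ideal (Rn n)) (hIP : ∀ n, ¬ pt n → I n ≤ P n ^ μ)
    (hcurve : ∀ n, ¬ pt n → ∀ (y w : Rn n), Ideal.span {y, u n} = P n →
      Ideal.span {y, u n, w} = maximalIdeal (Rn n) →
      (∀ G ∈ initialForms ![y, u n, w] (I n) μ, ∃ a : ResidueField (Rn n), G = C a * X 0 ^ μ) →
      ∃ y' : Rn (n + 1), φ n y = φ n (u n) * y' ∧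
        Ideal.span {y', φ n (u n), φ n w} = maximalIdeal (Rn (n + 1)))
    -- quasi-isolation at EVERY level, relative to the centre (critic R65 (1)(c); point steps: `pt n ∨ …`)
    (hqis : ∀ n (𝔮 : Ideal (Rn n)) [𝔮.IsPrime], 𝔮 ≠ maximalIdeal (Rn n) → (pt n ∨ 𝔮 ≠ P n) →
      ¬ (I n).map (algebraMap (Rn n) (Localization.AtPrime 𝔮)) ≤ maximalIdeal (Localization.AtPrime 𝔮) ^ μ)
    -- after a POINT step the next centre (if a curve) is the line `L_{x_n} = V(u, y′)` (ρ1; well-defined)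
    (hPsucc_pt : ∀ n, pt n → ¬ pt (n + 1) → ∀ (y w : Rn n) (y' : Rn (n + 1)),
      Ideal.span {y, u n, w} = maximalIdeal (Rn n) →
      (∀ G ∈ initialForms ![y, u n, w] (I n) μ, ∃ a : ResidueField (Rn n), G = C a * X 0 ^ μ) →
      φ n y = φ n (u n) * y' → Ideal.span {y', u (n + 1)} = P (n + 1))
    -- after a CURVE step the next centre (if a curve) is the strict transform of the centre, up to a
    -- correction `β ∈ 𝔪_n` of the presentation (critic R65 (1)(b) = p-8b's (P2), byte-verbatim)
    (hPsucc_cv : ∀ n, ¬ pt n → ¬ pt (n + 1) → ∀ (y w : Rn n) (y' : Rn (n + 1)),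
      Ideal.span {y, u n} = P n →
      Ideal.span {y, u n, w} = maximalIdeal (Rn n) →
      (∀ G ∈ initialForms ![y, u n, w] (I n) μ, ∃ a : ResidueField (Rn n), G = C a * X 0 ^ μ) →
      φ n y = φ n (u n) * y' →
      u (n + 1) ∈ P (n + 1) ∧ ∃ β ∈ maximalIdeal (Rn n), Ideal.span {y' + φ n β, u (n + 1)} = P (n + 1)) :
    False := by
  classical
  have _hqis := hqis -- quasi-isolation at the higher levels is not needed by architecture (B)
  -- B3: the shear-lifted third parameters
  obtain ⟨v, p, hv0, hp0, hpS, hvdiff, hvcv, hchain⟩ := exists_shearLift_coordinates Rn hdim φ I hμ u hu pt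
    hpt0 c₀ hc₀ hc₀u hδ₀ hIμ hIne hτ hres hI hpoint P hIP hcurve hPsucc_pt hPsucc_cv
  -- the completed chain
  haveI hreg : ∀ n, IsRegularLocalRing (AdicCompletion (maximalIdeal (Rn n)) (Rn n)) := fun n =>
    isRegularLocalRing_adicCompletion (Rn n)
  have hφm : ∀ n, (maximalIdeal (Rn n)).map (φ n) ≤ maximalIdeal (Rn (n + 1)) := fun n =>
    Ideal.map_le_iff_le_comap.mpr fun x hx => by
      rw [Ideal.mem_comap, mem_maximalIdeal, mem_nonunits_iff]
      exact fun h => ((mem_maximalIdeal _).mp hx) (isUnit_of_map_unit (φ n) x h)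
  have hdimh : ∀ n, ringKrullDim (AdicCompletion (maximalIdeal (Rn n)) (Rn n)) = 3 := fun n => by
    rw [ringKrullDim_adicCompletion, hdim n]
  -- stub B5a: the limit `v̂`; `(y₀, u₀, v̂)` generates `𝔪̂₀`
  have hu0 : u 0 ∈ maximalIdeal (Rn 0) := by
    rw [← hc₀u, ← hc₀]; exact Ideal.subset_span (by simp)
  obtain ⟨vh, hvh0, hvh⟩ := exists_adicLimit_of_shearLift (u 0) hu0 v p pt hp0 hpS hvdiff hvcv
  have hgenι : Ideal.span {algebraMap (Rn 0) (AdicCompletion (maximalIdeal (Rn 0)) (Rn 0)) (c₀ 0),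
      algebraMap (Rn 0) (AdicCompletion (maximalIdeal (Rn 0)) (Rn 0)) (c₀ 1),
      algebraMap (Rn 0) (AdicCompletion (maximalIdeal (Rn 0)) (Rn 0)) (c₀ 2)} =
      maximalIdeal (AdicCompletion (maximalIdeal (Rn 0)) (Rn 0)) := by
    have h := congrArg (Ideal.map (algebraMap (Rn 0) (AdicCompletion (maximalIdeal (Rn 0)) (Rn 0)))) hc₀
    rw [Ideal.map_span, Set.image_insert_eq, Set.image_insert_eq, Set.image_singleton,
      ← AdicCompletion.maximalIdeal_eq_map] at h
    exact h
  have hgenv : Ideal.span {algebraMap (Rn 0) (AdicCompletion (maximalIdeal (Rn 0)) (Rn 0)) (c₀ 0),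
      algebraMap (Rn 0) (AdicCompletion (maximalIdeal (Rn 0)) (Rn 0)) (c₀ 1), vh} =
      maximalIdeal (AdicCompletion (maximalIdeal (Rn 0)) (Rn 0)) := by
    obtain ⟨t, ht⟩ := Ideal.mem_span_singleton'.mp hvh0
    have hvh' : vh = algebraMap (Rn 0) (AdicCompletion (maximalIdeal (Rn 0)) (Rn 0)) (c₀ 2) +
        t * algebraMap (Rn 0) (AdicCompletion (maximalIdeal (Rn 0)) (Rn 0)) (c₀ 1) := by
      rw [hc₀u, ht, hv0, add_sub_cancel]
    rw [hvh', span_triple_add_mul_snd']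
    exact hgenι
  -- B4: the totally prepared `ŷ` at level `0`
  obtain ⟨yh, -, -, hgen0, hne0, hδ0, hprep0, hJ0⟩ := exists_totallyPrepared_adicCompletion hG c₀ hc₀ (hdim 0)
    (hIμ 0) hδ₀ hisol vh hgenv
  rw [hc₀u] at hgen0 hne0 hδ0 hprep0
  -- stub B5: the transported coordinate system
  obtain ⟨ch, hch0, hch1, hgench, h₀, h₂pt, h₂cv, hJcv⟩ := completedChain_transport Rn hdim φ hφm I u hu pt hIμ
    hIne hτ hres hI hpoint P hIP hcurve v hchain vh hvh yh hgen0 hne0 hδ0 hprep0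
  -- B6: the axial chain law in the completed chain
  refine false_of_axialChain (Rn := fun n => AdicCompletion (maximalIdeal (Rn n)) (Rn n))
    (fun n => adicCompletionMap (maximalIdeal (Rn n)) (maximalIdeal (Rn (n + 1))) (φ n) (hφm n)) ch
    (fun n => decide (pt n)) hgench hdimh
    (fun n => (I n).map (algebraMap (Rn n) (AdicCompletion (maximalIdeal (Rn n)) (Rn n)))) (μ := μ)
    (fun n => ?_) h₀ (fun n hn => h₂pt n (of_decide_eq_true hn))
    (fun n hn => h₂cv n (of_decide_eq_false hn))
    (fun n _ => map_le_pow_maximalIdeal_adicCompletion (hIμ n))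
    (fun n hn => hJcv n (of_decide_eq_false hn)) (fun n g hg => ?_) ?_
  · -- `h₁`: `u_{n+1} = φ̂ u_n`
    rw [hch1, hch1, hu n, adicCompletionMap_algebraMap]
  · -- the weak transform clause in the completed chain (B2)
    rw [hch1] at hg
    refine weakTransform_adicCompletion_of_le (φ n) (hφm n) (fun g' hg' => ?_) g hg
    rw [hI n, Submodule.mem_colon_singleton, smul_eq_mul, mul_comm]
    exact hg'
  · -- `hJ0`: `I₀ R̂₀ ⊄ (ŷ, v̂)^μ` (B4, isolation)
    rw [hch0]
    exact hJ0

end Literature.AlgebraicGeometry.Resolution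

end
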